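import Summits.BirchSwinnertonDyer.BirchSwinnertonDyer.Theorems.ClassRecordThreeEulerHalvesAtThreeCartanCoverTorusDocking
import Summits.BirchSwinnertonDyer.BirchSwinnertonDyer.Theorems.ClassRecordThreeEulerHalvesAtThreeCartanTransportHull
import Literature.NumberTheory.Automorphic.HypFundamentalDomainVolume
import Literature.NumberTheory.Automorphic.ShimuraCurve
import HarnessLib

/-!
# Crux NUM `CartanOnePlaceDegreeLawAtThree` (item 24801) — the GROUP-THEORETIC side of (SHEET)

Seat `bsd-stepL-tam3-p1` g30 (LEAD of 24801; `--supports` 24801). Bookkeeping lemmas for the finite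
unfolding `(SHEET)` of the `petarea` cut of the print conjunct `(PET)` (`Cruxes/…/Lines/petarea.lean`,
`def SheetUnfolding`), about the level groups `Γ_T = R.levelOf T` over a torus `T ≤ GL₂(𝔽_q)` and the
double coset `R.torusCoset T = H·T`, `H = redHom(ι(O₀'¹))`:

* `redHom_negOne`, `neg_one_mem_levelOf` — `redHom(−1) = −1`, so `−1 ∈ Γ_T` when `−1 ∈ T`;
* `levelOf_le_range_toGL`, `countable_levelOf`, `countable_principalLevel` — side conditions of the
  unfolding files;
* `relIndex_principalLevel_levelOf : [Γ_T : Γ̄(q)] = |H ∩ T|` (`Γ_T/Γ̄(q) ≅ H ∩ T` along `redHom`);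
* `ite_mul_relIndex_adjoinNegOne_levelOf : c · [Γ_T : Γ̄(q){±1}] = |H ∩ T|`, `c = 1` if `−1 ∈ Γ̄(q)` else `2`,
  and the finite-index instance it needs;
* `sum_ite_mem_torusCoset : Σ_{g ∈ GL₂(𝔽_q)} 𝟙[g ∈ H·T] · |H ∩ T| = |H| · |T|` (double counting of
  `H × T → H·T`, fibres `≃ H ∩ T`);
* `IsHypFundamentalDomain.adjoinNegOne` — a fundamental domain of `Γ` is one of `Γ{±1}` (`−1` acts trivially).

Elementary; nothing about degrees or any curve; BSD is proved for no curve.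
[cite: KohenPacetti2016, §2 (arXiv:1403.7801v3 pp. 7–8)] [cite: Iwaniec2002, §2.2–2.4]
-/

set_option linter.dupNamespace false
set_option autoImplicit false

noncomputable section

open scoped Classical Pointwise MatrixGroups
open MeasureTheory

namespace Literature.NumberTheory.Automorphic.IsHypFundamentalDomain

/-- A fundamental domain of `Γ ≤ GL₂(ℝ)` is a fundamental domain of `Γ{±1}` (`-1` acts trivially on `ℍ`). [folklore] -/
theorem adjoinNegOne {Γ : Subgroup (GL (Fin 2) ℝ)} {F : Set UpperHalfPlane}
    (hF : IsHypFundamentalDomain Γ F) : IsHypFundamentalDomain Γ.adjoinNegOne F := by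
  refine ⟨hF.measurableSet, fun z => ?_, ?_⟩
  · obtain ⟨γ, hγ, hz⟩ := hF.covers z
    exact ⟨γ, Γ.le_adjoinNegOne hγ, hz⟩
  · filter_upwards [hF.ae_unique] with z hz hzF γ hγ hγz
    rcases Subgroup.mem_adjoinNegOne_iff.mp hγ with h | h
    · exact hz hzF γ h hγz
    · have e : γ • z = (-γ) • z := (UpperHalfPlane.neg_smul γ z).symm
      rw [e] at hγz ⊢
      exact hz hzF (-γ) h hγz

end Literature.NumberTheory.Automorphic.IsHypFundamentalDomain

namespace Summit.BirchSwinnertonDyer.BirchSwinnertonDyer.Theorems.CartanCover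

open Literature.NumberTheory.Automorphic Literature.NumberTheory.EllipticCurves.ModularForms

variable {D M : ℕ} {C : Finset ℕ} {X : CartanLevelCurveData D M C} {q : ℕ}

/-- `ι(O₀'¹)` lies in the image of `SL₂(ℝ)` (norm-one units have determinant `1`). -/
theorem coverUnits_le_range_toGL (X : CartanLevelCurveData D M C) (q : ℕ) :
    coverUnits X q ≤ (Matrix.SpecialLinearGroup.toGL : SL(2, ℝ) →* GL (Fin 2) ℝ).range := by
  haveI : (coverUnits X q).HasDetOne := by unfold coverUnits; infer_instance
  exact le_range_toGL_of_hasDetOne _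

/-- `ι(O₀'¹)` is countable (discrete). -/
theorem countable_coverUnits (X : CartanLevelCurveData D M C) (q : ℕ) :
    ((coverUnits X q : Subgroup (GL (Fin 2) ℝ)) : Set (GL (Fin 2) ℝ)).Countable :=
  IsDiscreteSubgroup.countable (CartanTransport.Hull.isDiscreteSubgroup_normOneUnits X.ι (isOrder_coverOrder X q))

/-- `Γ̄(q)` is countable. -/
theorem countable_principalLevel (X : CartanLevelCurveData D M C) (q : ℕ) :
    ((principalLevel X q : Subgroup (GL (Fin 2) ℝ)) : Set (GL (Fin 2) ℝ)).Countable :=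
  (countable_coverUnits X q).mono (principalLevel_le_coverUnits X q)

/-- `-1 ∈ O₀'`. -/
theorem neg_one_mem_coverOrder (X : CartanLevelCurveData D M C) (q : ℕ) : (-1 : X.B) ∈ coverOrder X q :=
  (coverOrder X q).neg_mem (isOrder_coverOrder X q).one_mem

namespace CoverReduction

variable [Fact q.Prime] (R : CoverReduction X q)

omit [Fact q.Prime] R in
/-- The lift of the unit `-1` is `-1 ∈ O₀'`. -/
theorem unitLift_negOne : unitLift (⟨-1, neg_one_mem_coverUnits X q⟩ : coverUnits X q) =
    ⟨-1, neg_one_mem_coverOrder X q⟩ := by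
  apply unitLift_eq_of_ι_eq
  rw [map_neg, map_one]
  simp

/-- **`redHom(−1) = −1`.** -/
theorem redHom_negOne : R.redHom ⟨-1, neg_one_mem_coverUnits X q⟩ = -1 := by
  ext : 1
  rw [R.coe_redHom, unitLift_negOne]
  change R.red (-1) = _
  rw [map_neg, map_one]
  simp

/-- `−1 ∈ Γ_T` when `−1 ∈ T`. -/
theorem neg_one_mem_levelOf (T : Subgroup (GL (Fin 2) (ZMod q))) (hT : (-1 : GL (Fin 2) (ZMod q)) ∈ T) :
    (-1 : GL (Fin 2) ℝ) ∈ R.levelOf T :=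
  (R.mem_levelOf_iff T).mpr ⟨neg_one_mem_coverUnits X q, by rw [R.redHom_negOne]; exact hT⟩

/-- `Γ_T` lies in the image of `SL₂(ℝ)`. -/
theorem levelOf_le_range_toGL (T : Subgroup (GL (Fin 2) (ZMod q))) :
    R.levelOf T ≤ (Matrix.SpecialLinearGroup.toGL : SL(2, ℝ) →* GL (Fin 2) ℝ).range :=
  (R.levelOf_le T).trans (coverUnits_le_range_toGL X q)

/-- `Γ_T` is countable. -/
theorem countable_levelOf (T : Subgroup (GL (Fin 2) (ZMod q))) :
    ((R.levelOf T : Subgroup (GL (Fin 2) ℝ)) : Set (GL (Fin 2) ℝ)).Countable :=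
  (countable_coverUnits X q).mono (R.levelOf_le T)

omit [Fact q.Prime] in
/-- `Γ̄(q)` pulled back to `ι(O₀'¹)` is `ker redHom`. -/
theorem principalLevel_subgroupOf_coverUnits :
    (principalLevel X q).subgroupOf (coverUnits X q) = R.redHom.ker := by
  ext g
  rw [Subgroup.mem_subgroupOf, MonoidHom.mem_ker, R.mem_ker_redHom_iff]

/-- `Γ_T` pulled back to `ι(O₀'¹)` is `redHom⁻¹(T)`. -/
theorem levelOf_subgroupOf_coverUnits (T : Subgroup (GL (Fin 2) (ZMod q))) :
    (R.levelOf T).subgroupOf (coverUnits X q) = T.comap R.redHom := by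
  ext g
  rw [Subgroup.mem_subgroupOf, Subgroup.mem_comap, R.coe_mem_levelOf_iff]

/-- **`[Γ_T : Γ̄(q)] = |H ∩ T|`**, `H = redHom(ι(O₀'¹))`. -/
theorem relIndex_principalLevel_levelOf (T : Subgroup (GL (Fin 2) (ZMod q))) :
    (principalLevel X q).relIndex (R.levelOf T) = Nat.card ↥(R.redHom.range ⊓ T) := by
  rw [← Subgroup.relIndex_subgroupOf (R.levelOf_le T), R.principalLevel_subgroupOf_coverUnits,
    R.levelOf_subgroupOf_coverUnits, Subgroup.relIndex_ker, Subgroup.map_comap_eq]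

/-- `[Γ_T : Γ̄(q)] ≠ 0`. -/
theorem relIndex_principalLevel_levelOf_ne_zero (T : Subgroup (GL (Fin 2) (ZMod q))) :
    (principalLevel X q).relIndex (R.levelOf T) ≠ 0 := by
  rw [R.relIndex_principalLevel_levelOf T]
  haveI : Finite ↥(R.redHom.range ⊓ T) := inferInstance
  exact Nat.card_pos.ne'

/-- `Γ̄(q){±1} ≤ Γ_T` when `−1 ∈ T`. -/
theorem adjoinNegOne_principalLevel_le_levelOf (T : Subgroup (GL (Fin 2) (ZMod q)))
    (hT : (-1 : GL (Fin 2) (ZMod q)) ∈ T) : (principalLevel X q).adjoinNegOne ≤ R.levelOf T := by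
  intro g hg
  rcases Subgroup.mem_adjoinNegOne_iff.mp hg with h | h
  · exact R.principalLevel_le_levelOf T h
  · have h1 := (R.levelOf T).mul_mem (R.neg_one_mem_levelOf T hT) (R.principalLevel_le_levelOf T h)
    simpa using h1

/-- **`c · [Γ_T : Γ̄(q){±1}] = |H ∩ T|`** with `c = 1` if `−1 ∈ Γ̄(q)` and `c = 2` otherwise. -/
theorem ite_mul_relIndex_adjoinNegOne_levelOf (T : Subgroup (GL (Fin 2) (ZMod q)))
    (hT : (-1 : GL (Fin 2) (ZMod q)) ∈ T) :
    (if (-1 : GL (Fin 2) ℝ) ∈ principalLevel X q then 1 else 2 : ℕ) *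
        ((principalLevel X q).adjoinNegOne).relIndex (R.levelOf T) = Nat.card ↥(R.redHom.range ⊓ T) := by
  rw [← R.relIndex_principalLevel_levelOf T,
    ← Subgroup.relIndex_mul_relIndex (principalLevel X q) _ _ (Subgroup.le_adjoinNegOne _)
      (R.adjoinNegOne_principalLevel_le_levelOf T hT)]
  split_ifs with h
  · rw [Subgroup.adjoinNegOne_eq_self_iff.mpr h, Subgroup.relIndex_self]
  · rw [Subgroup.relindex_adjoinNegOne_eq_two h]

/-- `[Γ_T : Γ̄(q){±1}] ≠ 0`. -/
theorem relIndex_adjoinNegOne_levelOf_ne_zero (T : Subgroup (GL (Fin 2) (ZMod q)))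
    (hT : (-1 : GL (Fin 2) (ZMod q)) ∈ T) :
    ((principalLevel X q).adjoinNegOne).relIndex (R.levelOf T) ≠ 0 := by
  intro h0
  have h := R.ite_mul_relIndex_adjoinNegOne_levelOf T hT
  rw [h0, mul_zero, ← R.relIndex_principalLevel_levelOf T] at h
  exact R.relIndex_principalLevel_levelOf_ne_zero T h.symm

/-- The finite-index instance the unfolding needs. -/
theorem finiteIndex_adjoinNegOne_subgroupOf_levelOf (T : Subgroup (GL (Fin 2) (ZMod q)))
    (hT : (-1 : GL (Fin 2) (ZMod q)) ∈ T) :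
    (((principalLevel X q).adjoinNegOne).subgroupOf (R.levelOf T)).FiniteIndex :=
  ⟨R.relIndex_adjoinNegOne_levelOf_ne_zero T hT⟩

/-! ## The double coset `H·T` : `|H·T| · |H ∩ T| = |H| · |T|` -/

/-- Membership in the double coset: `g ∈ H·T ↔ ∃ h ∈ H, h⁻¹ g ∈ T`. -/
theorem mem_torusCoset_iff' (T : Subgroup (GL (Fin 2) (ZMod q))) (g : GL (Fin 2) (ZMod q)) :
    g ∈ R.torusCoset T ↔ ∃ h : R.redHom.range, ((h : GL (Fin 2) (ZMod q)))⁻¹ * g ∈ T := by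
  rw [R.mem_torusCoset_iff]
  constructor
  · rintro ⟨γ, hγ⟩; exact ⟨⟨R.redHom γ, γ, rfl⟩, hγ⟩
  · rintro ⟨⟨_, γ, rfl⟩, hγ⟩; exact ⟨γ, hγ⟩

/-- For `g = h₀ t₀ ∈ H·T`: `#{h ∈ H : h⁻¹ g ∈ T} = |H ∩ T|`. -/
theorem sum_ite_inv_mul_mem_eq_card (T : Subgroup (GL (Fin 2) (ZMod q))) {g : GL (Fin 2) (ZMod q)}
    (h₀ : R.redHom.range) (hg : ((h₀ : GL (Fin 2) (ZMod q)))⁻¹ * g ∈ T) :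
    ∑ h : R.redHom.range, (if ((h : GL (Fin 2) (ZMod q)))⁻¹ * g ∈ T then 1 else 0) =
      Nat.card ↥(R.redHom.range ⊓ T) := by
  -- reindex `h ↦ h₀ h`
  have hre : ∑ h : R.redHom.range, (if ((h : GL (Fin 2) (ZMod q)))⁻¹ * g ∈ T then 1 else 0) =
      ∑ h : R.redHom.range, (if ((h₀ * h : R.redHom.range) : GL (Fin 2) (ZMod q))⁻¹ * g ∈ T then 1 else 0) :=
    (Fintype.sum_equiv (Equiv.mulLeft h₀) _ _ (fun h => rfl)).symm
  rw [hre]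
  have hiff : ∀ h : R.redHom.range,
      ((h₀ * h : R.redHom.range) : GL (Fin 2) (ZMod q))⁻¹ * g ∈ T ↔ (h : GL (Fin 2) (ZMod q)) ∈ T := by
    intro h
    rw [Subgroup.coe_mul, _root_.mul_inv_rev, mul_assoc]
    constructor
    · intro h1
      have h2 := T.mul_mem h1 (T.inv_mem hg)
      rw [mul_inv_cancel_right] at h2
      simpa using T.inv_mem h2
    · intro h1
      exact T.mul_mem (T.inv_mem h1) hg
  simp_rw [hiff]
  rw [Finset.sum_boole, Nat.cast_id, ← Fintype.card_subtype]
  let e : ↥(R.redHom.range ⊓ T) ≃ {h : R.redHom.range // (h : GL (Fin 2) (ZMod q)) ∈ T} :=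
    { toFun := fun x => ⟨⟨x.1, (Subgroup.mem_inf.mp x.2).1⟩, (Subgroup.mem_inf.mp x.2).2⟩
      invFun := fun y => ⟨y.1.1, Subgroup.mem_inf.mpr ⟨y.1.2, y.2⟩⟩
      left_inv := fun x => rfl
      right_inv := fun y => rfl }
  rw [Nat.card_congr e, Nat.card_eq_fintype_card]

/-- **`Σ_g 𝟙[g ∈ H·T] · |H ∩ T| = |H| · |T|`** (double counting of `(h, t) ↦ h t`). -/
theorem sum_ite_mem_torusCoset (T : Subgroup (GL (Fin 2) (ZMod q))) :
    (∑ g : GL (Fin 2) (ZMod q), (if g ∈ R.torusCoset T then 1 else 0)) * Nat.card ↥(R.redHom.range ⊓ T) =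
      Nat.card R.redHom.range * Nat.card T := by
  -- `S := Σ_g Σ_h Σ_t 𝟙[h t = g]`, computed in two ways
  have way1 : ∑ g : GL (Fin 2) (ZMod q), ∑ h : R.redHom.range, ∑ t : T,
      (if (h : GL (Fin 2) (ZMod q)) * t = g then 1 else 0) = Nat.card R.redHom.range * Nat.card T := by
    rw [Finset.sum_comm]
    have e : ∀ h : R.redHom.range, ∑ g : GL (Fin 2) (ZMod q), ∑ t : T,
        (if (h : GL (Fin 2) (ZMod q)) * t = g then 1 else 0) = Nat.card T := by
      intro h
      rw [Finset.sum_comm]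
      have e2 : ∀ t : T, ∑ g : GL (Fin 2) (ZMod q), (if (h : GL (Fin 2) (ZMod q)) * t = g then 1 else 0) = 1 :=
        fun t => by rw [Finset.sum_ite_eq]; simp
      simp_rw [e2]
      simp [Nat.card_eq_fintype_card]
    simp_rw [e]
    simp [Nat.card_eq_fintype_card]
  have way2 : ∀ g : GL (Fin 2) (ZMod q), ∑ h : R.redHom.range, ∑ t : T,
      (if (h : GL (Fin 2) (ZMod q)) * t = g then 1 else 0) =
        (if g ∈ R.torusCoset T then 1 else 0) * Nat.card ↥(R.redHom.range ⊓ T) := by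
    intro g
    have e : ∀ h : R.redHom.range, ∑ t : T, (if (h : GL (Fin 2) (ZMod q)) * t = g then 1 else 0) =
        if ((h : GL (Fin 2) (ZMod q)))⁻¹ * g ∈ T then 1 else 0 := by
      intro h
      have e1 : ∀ t : T, ((h : GL (Fin 2) (ZMod q)) * t = g) ↔ ((t : GL (Fin 2) (ZMod q)) = (h : GL (Fin 2) (ZMod q))⁻¹ * g) := by
        intro t; rw [eq_inv_mul_iff_mul_eq]
      simp_rw [e1]
      set y : GL (Fin 2) (ZMod q) := (h : GL (Fin 2) (ZMod q))⁻¹ * g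
      by_cases hy : y ∈ T
      · rw [if_pos hy, Finset.sum_eq_single ⟨y, hy⟩]
        · simp
        · intro b _ hb
          rw [if_neg]
          intro h; exact hb (Subtype.ext h)
        · intro h; exact absurd (Finset.mem_univ _) h
      · rw [if_neg hy]
        refine Finset.sum_eq_zero fun s _ => ?_
        rw [if_neg]
        rintro hs; exact hy (hs ▸ s.2)
    simp_rw [e]
    by_cases hg : g ∈ R.torusCoset T
    · rw [if_pos hg, one_mul]
      obtain ⟨h₀, h₀g⟩ := (R.mem_torusCoset_iff' T g).mp hg
      exact R.sum_ite_inv_mul_mem_eq_card T h₀ h₀g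
    · rw [if_neg hg, zero_mul]
      refine Finset.sum_eq_zero fun h _ => ?_
      rw [if_neg]
      intro h1
      exact hg ((R.mem_torusCoset_iff' T g).mpr ⟨h, h1⟩)
  rw [← way1]
  simp_rw [way2]
  rw [Finset.sum_mul]

end CoverReduction

end Summit.BirchSwinnertonDyer.BirchSwinnertonDyer.Theorems.CartanCover

end
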